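import Summits.AnomalousDissipation.AnomalousDissipation.Theorems.MarginalStabilityChainBurgersLayerLowReEnergy
import Summits.AnomalousDissipation.AnomalousDissipation.Theorems.MarginalStabilityChainBurgersLayerLowRePoincare
import Summits.AnomalousDissipation.AnomalousDissipation.Theorems.MarginalStabilityChainBurgersLayerLowReMass
import Summits.AnomalousDissipation.AnomalousDissipation.Theorems.MarginalStabilityChainBurgersLayerLowRePrep
import Summits.AnomalousDissipation.AnomalousDissipation.Theses.MarginalStabilityChain

/-!
# Route MarginalStabilityChain · BurgersLayerLowRe — THE SWEET–PARKER REGIME EXISTS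

Settles stmt-AnomalousDissipation-3010 (`BurgersLayerLowRe`, support item of route
`AnomalousDissipation/MarginalStabilityChain`): unconditional spectral stability of the Burgers vortex
layer below a critical Reynolds number, UNIFORMLY in the wavenumber `α > 0` — in similarity variables,
for `0 ≤ Re < Re₁` the linearised stretched vorticity equation
`σω = −iαRe(Uω + U''ψ) + ω + yω' + ω'' − α²ω` (`U = ∫₀ʸe^{−s²/2}`, `ω = −(ψ'' − α²ψ)`) has no mode
`ψ ∈ C⁴`, `ψ → 0` at `±∞`, `|ω| ≤ Ce^{−y²/4}`, with `re σ ≥ 0` other than `ψ ≡ 0`.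

## Proof (energy–mass method; new — the printed sources are numerical/asymptotic:
Beronov–Kida 1996, Neu 1984)

1. `ψ = Tω` is the Green potential of its vorticity (bounded solutions of `d'' = α²d` vanish), so
   `‖ψ‖∞ ≤ ‖ω‖₁/2α`; the equation upgrades `|ω| ≤ Ce^{−y²/4}` to Gaussian bounds on `ω', ω''`.
2. ENERGY (`energy_ineq`, weight `e^{θy²/2}`, `θ = 1 − min(α², ½)`):
   `D := ∫e^{θy²/2}‖ω' + θyω‖² ≤ αRe‖ψ‖∞∫|y|‖ω‖ ≤ (Re/2)‖ω‖₁∫|y|‖ω‖`.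
3. MASS (`integral_mode_eq`, `coupling_integral_eq`): `(σ + α²)∫ω = −iα³Re∫Vω` with `V = TU` odd and
   `|V(y)| ≤ K_U|y|/α`; since `∫Ve^{−θy²/2} = 0`, `‖∫ω‖ ≤ Re K_U N₁`, `N₁ := ∫(1+|y|)‖ω − ω(0)e^{−θy²/2}‖`.
4. POINCARÉ SUBSTITUTE (`norm_sub_gauss_le`): `N₁ ≤ K_P √D`.
5. Bookkeeping: `‖ω‖₁, ∫|y|‖ω‖ ≲ (1+Re)N₁`, hence `D ≤ Re·K·D` with a universal `K`; for
   `Re < Re₁ := min(1, 1/(K+1))` this forces `D = 0`, then `N₁ = 0`, `∫ω = 0`, `ω(0) = 0`, `ω ≡ 0`,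
   and `ψ'' = α²ψ` bounded gives `ψ ≡ 0`.
-/

noncomputable section

open MeasureTheory Set Filter Topology
open scoped Real RealInnerProductSpace Interval

namespace Summit.AnomalousDissipation.AnomalousDissipation.Theorems.MarginalStabilityChainBurgersLayerLowRe

-- the summit and its single sub-problem share the name `AnomalousDissipation` (tree layout D-0017)
set_option linter.dupNamespace false

open Literature.Analysis.ODE

/-! ### The theorem -/

section Main
open Summit.AnomalousDissipation.AnomalousDissipation.Theses.MarginalStabilityChain

/-- **The Sweet–Parker regime exists: unconditional spectral stability of the Burgers vortex layer
below a critical Reynolds number, uniformly in the wavenumber** (settles item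
stmt-AnomalousDissipation-3010, `BurgersLayerLowRe`). There is `Re₁ > 0` such that for
`0 ≤ Re < Re₁`, every `α > 0` and every `σ` with `re σ ≥ 0`, the only `C⁴` stream function `ψ → 0` at
`±∞` with Gaussian-class vorticity `|ω| ≤ Ce^{−y²/4}` solving the linearised stretched vorticity
equation `σω = −iαRe(Uω + U''ψ) + ω + yω' + ω'' − α²ω` is `ψ ≡ 0`.

Proof (energy–mass method, new): with `θ = 1 − min(α², 1/2)` the weighted energy identity gives
`D² := ∫e^{θy²/2}‖ω' + θyω‖² ≤ (Re/2)‖ω‖₁ ∫|y|‖ω‖` (`energy_ineq`, the Green bound `‖ψ‖∞ ≤ ‖ω‖₁/2α`);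
the integrated equation and the symmetry of the Green operator give the mass bound
`‖∫ω‖ ≤ Re K_U ∫(1+|y|)‖ω⊥‖` (`integral_mode_eq`, `coupling_integral_eq`, parity), where
`ω⊥ = ω − ω(0)e^{−θy²/2}` obeys the pointwise Poincaré substitute `∫(1+|y|)‖ω⊥‖ ≤ K_P D`
(`norm_sub_gauss_le`). Hence `D² ≤ Re·K·D²` with a universal `K`, so `D = 0`, `ω⊥ = 0`, `∫ω = 0`,
`ω = 0` and finally `ψ = 0` for `Re < Re₁ := min(1, 1/(K+1))`. -/
theorem burgersLayerLowRe_proof : BurgersLayerLowRe := by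
  -- universal constants
  set KU : ℝ := ∫ y : ℝ, Real.exp (-(1 / 2) * y ^ 2) with hKU
  set KG : ℝ := ∫ y : ℝ, Real.exp (-(1 / 4) * y ^ 2) with hKG
  set KG' : ℝ := ∫ y : ℝ, |y| * Real.exp (-(1 / 4) * y ^ 2) with hKG'
  set KP : ℝ := ∫ y : ℝ, (1 + 2 * |y| + y ^ 2) * Real.exp (-(1 / 8) * y ^ 2) with hKP
  have hKUpos : 0 < KU := by
    rw [hKU, integral_gaussian]; exact Real.sqrt_pos.2 (by positivity)
  have hKG0 : 0 ≤ KG := integral_nonneg fun y => (Real.exp_pos _).le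
  have hKG'0 : 0 ≤ KG' := integral_nonneg fun y => by positivity
  have hKP0 : 0 ≤ KP := integral_nonneg fun y => by positivity
  set k₁ : ℝ := 1 + KU⁻¹ with hk₁
  have hk₁0 : 0 ≤ k₁ := by have := inv_pos.2 hKUpos; positivity
  set Kstar : ℝ := 1 / 2 * (1 + k₁ * KG) * (1 + k₁ * KG') * KP ^ 2 with hKstar
  have hKstar0 : 0 ≤ Kstar := by positivity
  refine ⟨min 1 (1 / (Kstar + 1)), lt_min one_pos (by positivity), ?_⟩
  intro Re hRe0 hRe1 α σ ψ U U'' ω hα hσ hψ htop hbot hC heq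
  have hRe1' : Re ≤ 1 := (hRe1.trans_le (min_le_left _ _)).le
  have hReK : Re * Kstar < 1 := mul_lt_one_of_lt_inv hKstar0 hRe0 (hRe1.trans_le (min_le_right _ _))
  ------------------------------------------------------------------
  -- Step 0: derivatives of the vorticity and the rewritten equation
  ------------------------------------------------------------------
  set ω₁ : ℝ → ℂ := fun y => -(iteratedDeriv 3 ψ y - (α : ℂ) ^ 2 * deriv ψ y) with hω₁
  set ω₂ : ℝ → ℂ := fun y => -(iteratedDeriv 4 ψ y - (α : ℂ) ^ 2 * iteratedDeriv 2 ψ y) with hω₂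
  have hd1 : ∀ y, HasDerivAt ω (ω₁ y) y := fun y => hasDerivAt_vorticity hψ ((α : ℂ) ^ 2) y
  have hd2 : ∀ y, HasDerivAt ω₁ (ω₂ y) y := fun y => hasDerivAt_vorticity' hψ ((α : ℂ) ^ 2) y
  have hderiv : deriv ω = ω₁ := deriv_vorticity hψ ((α : ℂ) ^ 2)
  have hderiv2 : iteratedDeriv 2 ω = ω₂ := iteratedDeriv_two_vorticity hψ ((α : ℂ) ^ 2)
  have hω₂c : Continuous ω₂ := by
    simp only [hω₂]
    exact ((hψ.continuous_iteratedDeriv 4 (by norm_num)).sub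
      (continuous_const.mul (hψ.continuous_iteratedDeriv 2 (by norm_num)))).neg
  have hωc : Continuous ω := continuous_iff_continuousAt.2 fun y => (hd1 y).continuousAt
  have hω₁c : Continuous ω₁ := continuous_iff_continuousAt.2 fun y => (hd2 y).continuousAt
  have hψc : Continuous ψ := hψ.continuous
  set a : ℝ := α * Re with ha
  have ha0 : 0 ≤ a := mul_nonneg hα.le hRe0
  have heq' : ∀ y, σ * ω y = -(Complex.I * a) * ((U y : ℂ) * ω y + (U'' y : ℂ) * ψ y) + ω y +
      y * ω₁ y + ω₂ y - (α : ℂ) ^ 2 * ω y := fun y => by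
    have h := heq y
    rw [hderiv, hderiv2] at h
    rw [h, ha, Complex.ofReal_mul]; ring
  have hψ0 : ∀ y, HasDerivAt ψ (deriv ψ y) y := fun y => (hψ.differentiable (by norm_num) y).hasDerivAt
  have hψ1 : ∀ y, HasDerivAt (deriv ψ) ((α : ℂ) ^ 2 * ψ y - ω y) y := fun y =>
    (hasDerivAt_deriv_of_contDiff hψ y).congr_deriv (by
      show iteratedDeriv 2 ψ y = (α : ℂ) ^ 2 * ψ y - -(iteratedDeriv 2 ψ y - (α : ℂ) ^ 2 * ψ y); ring)
  ------------------------------------------------------------------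
  -- Step 1: boundedness
  ------------------------------------------------------------------
  obtain ⟨C, hCω⟩ := hC
  have hC0 : 0 ≤ C := by
    have h := hCω 0
    simp only [ne_eq, OfNat.ofNat_ne_zero, not_false_eq_true, zero_pow, neg_zero, zero_div, Real.exp_zero, mul_one] at h
    exact (norm_nonneg _).trans h
  have hEle : ∀ y : ℝ, Real.exp (-(y ^ 2) / 4) ≤ 1 := exp_quarter_le_one
  have hωbdd : ∀ y, ‖ω y‖ ≤ C := fun y => (hCω y).trans (mul_le_of_le_one_right hC0 (hEle y))
  obtain ⟨Bψ, hBψ⟩ := exists_norm_le_of_tendsto hψc htop hbot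
  have hBψ0 : 0 ≤ Bψ := (norm_nonneg _).trans (hBψ 0)
  have iω : Integrable ω := by
    refine integrable_of_norm_le_gauss hωc.aestronglyMeasurable (by norm_num : (0 : ℝ) < 1 / 4) (A := C) (B := 0) (D := 0)
      fun y => ?_
    rw [← exp_quarter]; refine (hCω y).trans (le_of_eq ?_); ring
  ------------------------------------------------------------------
  -- Step 2: the profile `U`
  ------------------------------------------------------------------
  have hUd : ∀ y, HasDerivAt U (Real.exp (-(y ^ 2) / 2)) y := fun y => hasDerivAt_erfProfile y
  have hU'd : ∀ y, HasDerivAt (fun u : ℝ => Real.exp (-(u ^ 2) / 2)) (U'' y) y := fun y => hasDerivAt_gaussHalf y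
  have hUb : ∀ y, |U y| ≤ KU := fun y => abs_erfProfile_le y
  have hUodd : ∀ y, U (-y) = -U y := fun y => erfProfile_neg y
  have hUc : Continuous U := continuous_iff_continuousAt.2 fun y => (hUd y).continuousAt
  have hU''c : Continuous U'' := by show Continuous fun y : ℝ => -(y * Real.exp (-(y ^ 2) / 2)); fun_prop
  have hU''b : ∀ y, |U'' y| ≤ |y| * Real.exp (-(y ^ 2) / 2) := fun y => by
    show |-(y * Real.exp (-(y ^ 2) / 2))| ≤ _
    rw [abs_neg, abs_mul, abs_of_pos (Real.exp_pos _)]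
  have hEE : ∀ y : ℝ, Real.exp (-(y ^ 2) / 2) = Real.exp (-(y ^ 2) / 4) * Real.exp (-(y ^ 2) / 4) := fun y => by
    rw [← Real.exp_add]; congr 1; ring
  have hU''b1 : ∀ y, |U'' y| ≤ 1 := fun y => by
    refine (hU''b y).trans ?_
    rw [hEE, ← mul_assoc]
    calc |y| * Real.exp (-(y ^ 2) / 4) * Real.exp (-(y ^ 2) / 4) ≤ 1 * 1 :=
          mul_le_mul (abs_mul_exp_quarter_le_one y) (hEle y) (Real.exp_pos _).le zero_le_one
      _ = 1 := one_mul _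
  have iU'' : Integrable U'' := by
    have h := (integrable_mul_exp_neg_mul_sq (b := 1 / 2) (by norm_num)).neg
    refine h.congr (Eventually.of_forall fun y => ?_)
    show -(y * Real.exp (-(1 / 2) * y ^ 2)) = -(y * Real.exp (-(y ^ 2) / 2))
    rw [exp_half]
  ------------------------------------------------------------------
  -- Step 3: a priori Gaussian decay of `ω'`, `ω''`
  ------------------------------------------------------------------
  set K : ℝ := (‖σ‖ + 1 + α ^ 2) * C + a * (KU * C + Bψ) with hK
  have hK0 : 0 ≤ K := by have := hKUpos.le; positivity
  have hR : ∀ y, ‖ω₂ y + y * ω₁ y‖ ≤ K * Real.exp (-(y ^ 2) / 4) := fun y => by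
    have h : ω₂ y + y * ω₁ y = σ * ω y + (Complex.I * a) * ((U y : ℂ) * ω y + (U'' y : ℂ) * ψ y) - ω y +
        (α : ℂ) ^ 2 * ω y := by linear_combination (-1 : ℂ) * heq' y
    rw [h]
    have e := hCω y
    have hE0 : 0 < Real.exp (-(y ^ 2) / 4) := Real.exp_pos _
    have t1 : ‖σ * ω y‖ ≤ ‖σ‖ * (C * Real.exp (-(y ^ 2) / 4)) := by rw [norm_mul]; gcongr
    have t2 : ‖(Complex.I * a) * ((U y : ℂ) * ω y + (U'' y : ℂ) * ψ y)‖ ≤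
        a * (KU * (C * Real.exp (-(y ^ 2) / 4)) + Real.exp (-(y ^ 2) / 4) * Bψ) := by
      rw [norm_mul, norm_mul, Complex.norm_I, one_mul, Complex.norm_real, Real.norm_of_nonneg ha0]
      gcongr
      refine (norm_add_le _ _).trans (add_le_add ?_ ?_)
      · rw [norm_mul, Complex.norm_real, Real.norm_eq_abs]; gcongr; exact hUb y
      · rw [norm_mul, Complex.norm_real, Real.norm_eq_abs]
        refine mul_le_mul ((hU''b y).trans ?_) (hBψ y) (norm_nonneg _) hE0.le
        rw [hEE, ← mul_assoc]
        exact mul_le_of_le_one_left hE0.le (abs_mul_exp_quarter_le_one y)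
    have t3 : ‖ω y‖ ≤ C * Real.exp (-(y ^ 2) / 4) := e
    have t4 : ‖(α : ℂ) ^ 2 * ω y‖ ≤ α ^ 2 * (C * Real.exp (-(y ^ 2) / 4)) := by
      rw [norm_mul, norm_pow, Complex.norm_real, Real.norm_of_nonneg hα.le]; gcongr
    calc ‖σ * ω y + Complex.I * ↑a * (↑(U y) * ω y + ↑(U'' y) * ψ y) - ω y + (α : ℂ) ^ 2 * ω y‖
        ≤ ‖σ * ω y‖ + ‖Complex.I * ↑a * (↑(U y) * ω y + ↑(U'' y) * ψ y)‖ + ‖ω y‖ + ‖(α : ℂ) ^ 2 * ω y‖ := by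
          refine (norm_add_le _ _).trans (add_le_add ((norm_sub_le _ _).trans (add_le_add (norm_add_le _ _) le_rfl)) le_rfl)
      _ ≤ ‖σ‖ * (C * Real.exp (-(y ^ 2) / 4)) + a * (KU * (C * Real.exp (-(y ^ 2) / 4)) + Real.exp (-(y ^ 2) / 4) * Bψ) +
          C * Real.exp (-(y ^ 2) / 4) + α ^ 2 * (C * Real.exp (-(y ^ 2) / 4)) := by gcongr
      _ = K * Real.exp (-(y ^ 2) / 4) := by rw [hK]; ring
  have hω₁b : ∀ y, ‖ω₁ y‖ ≤ (‖ω₁ 0‖ + K * |y|) * Real.exp (-(y ^ 2) / 4) := norm_deriv_le_gauss hd2 hω₂c hR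
  have hω₂b : ∀ y, ‖ω₂ y‖ ≤ (K + ‖ω₁ 0‖ * |y| + K * y ^ 2) * Real.exp (-(y ^ 2) / 4) := fun y => by
    have h : ω₂ y = (ω₂ y + y * ω₁ y) - y * ω₁ y := by ring
    rw [h]
    refine (norm_sub_le _ _).trans ?_
    have h2 : ‖(y : ℂ) * ω₁ y‖ ≤ |y| * ((‖ω₁ 0‖ + K * |y|) * Real.exp (-(y ^ 2) / 4)) := by
      rw [norm_mul, Complex.norm_real, Real.norm_eq_abs]; gcongr; exact hω₁b y
    refine (add_le_add (hR y) h2).trans (le_of_eq ?_)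
    have : |y| * |y| = y ^ 2 := by rw [← sq, sq_abs]
    linear_combination (K * Real.exp (-(y ^ 2) / 4)) * this
  -- integrability consequences
  have iω₁ : Integrable ω₁ := by
    refine integrable_of_norm_le_gauss hω₁c.aestronglyMeasurable (by norm_num : (0 : ℝ) < 1 / 4) (A := ‖ω₁ 0‖)
      (B := K) (D := 0) fun y => ?_
    rw [← exp_quarter]; refine (hω₁b y).trans (le_of_eq ?_); ring
  have iω₂ : Integrable ω₂ := by
    refine integrable_of_norm_le_gauss hω₂c.aestronglyMeasurable (by norm_num : (0 : ℝ) < 1 / 4) (A := K)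
      (B := ‖ω₁ 0‖) (D := K) fun y => ?_
    rw [← exp_quarter]; exact hω₂b y
  have iyω : Integrable fun y : ℝ => (y : ℂ) * ω y := by
    refine integrable_of_norm_le_gauss (by fun_prop) (by norm_num : (0 : ℝ) < 1 / 4) (A := 0) (B := C) (D := 0)
      fun y => ?_
    rw [← exp_quarter, norm_mul, Complex.norm_real, Real.norm_eq_abs]
    calc |y| * ‖ω y‖ ≤ |y| * (C * Real.exp (-(y ^ 2) / 4)) := by gcongr; exact hCω y
      _ = (0 + C * |y| + 0 * y ^ 2) * Real.exp (-(y ^ 2) / 4) := by ring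
  have iyω₁ : Integrable fun y : ℝ => (y : ℂ) * ω₁ y := by
    refine integrable_of_norm_le_gauss (by fun_prop) (by norm_num : (0 : ℝ) < 1 / 4) (A := 0) (B := ‖ω₁ 0‖) (D := K)
      fun y => ?_
    rw [← exp_quarter, norm_mul, Complex.norm_real, Real.norm_eq_abs]
    calc |y| * ‖ω₁ y‖ ≤ |y| * ((‖ω₁ 0‖ + K * |y|) * Real.exp (-(y ^ 2) / 4)) := by gcongr; exact hω₁b y
      _ = (0 + ‖ω₁ 0‖ * |y| + K * y ^ 2) * Real.exp (-(y ^ 2) / 4) := by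
          have : |y| * |y| = y ^ 2 := by rw [← sq, sq_abs]
          linear_combination (K * Real.exp (-(y ^ 2) / 4)) * this
  have iF : Integrable fun y => (U y : ℂ) * ω y + (U'' y : ℂ) * ψ y := by
    refine Integrable.add ?_ ?_
    · exact iω.bdd_mul (c := KU) (by fun_prop) (Eventually.of_forall fun y => by
        rw [Complex.norm_real, Real.norm_eq_abs]; exact hUb y)
    · exact (iU''.ofReal (𝕜 := ℂ)).mul_bdd hψc.aestronglyMeasurable (Eventually.of_forall hBψ)
  ------------------------------------------------------------------
  -- Step 4: `ψ` is the Green potential of `ω`; the weight exponent `θ`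
  ------------------------------------------------------------------
  have hψT : ψ = fun y => (2 * (α : ℂ))⁻¹ * ∫ s, ((Real.exp (-(α * |y - s|)) : ℝ) : ℂ) * ω s :=
    eq_green_of_bounded hα hωc hωbdd rfl hψ0 hψ1 hBψ
  have hψb' : ∀ y, ‖ψ y‖ ≤ (2 * α)⁻¹ * ∫ s, ‖ω s‖ := green_norm_le_integral hα iω hψT
  set δ : ℝ := min (α ^ 2) (1 / 2) with hδ
  set θ : ℝ := 1 - δ with hθ
  have hδpos : 0 < δ := lt_min (by positivity) (by norm_num)
  have hδle : δ ≤ 1 / 2 := min_le_right _ _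
  have hδα : δ ≤ α ^ 2 := min_le_left _ _
  have hθ0 : 0 < θ := by rw [hθ]; linarith only [hδle]
  have hθ1 : θ < 1 := by rw [hθ]; linarith only [hδpos]
  have hθhalf : 1 / 2 ≤ θ := by rw [hθ]; linarith only [hδle]
  have hσ' : (1 - θ) / 2 ≤ σ.re + α ^ 2 := by rw [hθ]; linarith only [hδα, hσ, hδpos]
  ------------------------------------------------------------------
  -- Step 5: the energy inequality and the Poincaré substitute
  ------------------------------------------------------------------
  obtain ⟨iD, hD⟩ := energy_ineq hθ0 hθ1 hd1 hd2 hω₂c hψc hU''c hC0 (norm_nonneg _) hK0 hCω hω₁b hω₂b hψb' hU''b heq' hσ'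
  set D : ℝ := ∫ y, Real.exp (θ * y ^ 2 / 2) * ‖ω₁ y + ((θ * y : ℝ) : ℂ) * ω y‖ ^ 2 with hDdef
  have hD0 : 0 ≤ D := integral_nonneg fun y => by positivity
  have hP : ∀ y, ‖ω y - ((Real.exp (-(θ * y ^ 2 / 2)) : ℝ) : ℂ) * ω 0‖ ≤
      Real.exp (-(θ * y ^ 2 / 4)) * Real.sqrt (|y| * D) := fun y => norm_sub_gauss_le hθ0.le hd1 hω₁c iD y
  ------------------------------------------------------------------
  -- Step 6: the Gaussian decomposition and `N₁ ≤ K_P √D`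
  ------------------------------------------------------------------
  set N₁ : ℝ := ∫ y, (1 + |y|) * ‖ω y - ((Real.exp (-(θ * y ^ 2 / 2)) : ℝ) : ℂ) * ω 0‖ with hN₁
  obtain ⟨iN, hS₁, hS₂, hc₀⟩ := gauss_decomposition_bounds hθhalf hθ1.le hωc hCω hN₁
  have hN₁0 : 0 ≤ N₁ := integral_nonneg fun y => by positivity
  have iKP : Integrable fun y : ℝ => (1 + 2 * |y| + y ^ 2) * Real.exp (-(1 / 8) * y ^ 2) :=
    integrable_of_norm_le_gauss (by fun_prop) (by norm_num : (0 : ℝ) < 1 / 8) (A := 1) (B := 2) (D := 1) fun y => by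
      rw [Real.norm_of_nonneg (by positivity)]; refine le_of_eq ?_; ring
  have hN₁D : N₁ ≤ KP * Real.sqrt D := by
    have hpt : ∀ y, (1 + |y|) * ‖ω y - ((Real.exp (-(θ * y ^ 2 / 2)) : ℝ) : ℂ) * ω 0‖ ≤
        ((1 + 2 * |y| + y ^ 2) * Real.exp (-(1 / 8) * y ^ 2)) * Real.sqrt D := fun y => by
      have h1 := hP y
      have h2 : Real.exp (-(θ * y ^ 2 / 4)) ≤ Real.exp (-(1 / 8) * y ^ 2) := exp_neg_theta_quarter_le hθhalf y
      have h3 : Real.sqrt (|y| * D) = Real.sqrt |y| * Real.sqrt D := Real.sqrt_mul (abs_nonneg _) _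
      have h4 : (1 + |y|) * Real.sqrt |y| ≤ 1 + 2 * |y| + y ^ 2 := one_add_abs_mul_sqrt_le y
      calc (1 + |y|) * ‖ω y - ((Real.exp (-(θ * y ^ 2 / 2)) : ℝ) : ℂ) * ω 0‖
          ≤ (1 + |y|) * (Real.exp (-(θ * y ^ 2 / 4)) * Real.sqrt (|y| * D)) := by gcongr
        _ = ((1 + |y|) * Real.sqrt |y|) * Real.exp (-(θ * y ^ 2 / 4)) * Real.sqrt D := by rw [h3]; ring
        _ ≤ (1 + 2 * |y| + y ^ 2) * Real.exp (-(1 / 8) * y ^ 2) * Real.sqrt D := by gcongr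
        _ = ((1 + 2 * |y| + y ^ 2) * Real.exp (-(1 / 8) * y ^ 2)) * Real.sqrt D := by ring
    calc N₁ ≤ ∫ y, ((1 + 2 * |y| + y ^ 2) * Real.exp (-(1 / 8) * y ^ 2)) * Real.sqrt D :=
          integral_mono iN (iKP.mul_const _) hpt
      _ = KP * Real.sqrt D := by rw [integral_mul_const]
  ------------------------------------------------------------------
  -- Step 7: the mass bound `‖∫ω‖ ≤ Re K_U N₁`
  ------------------------------------------------------------------
  set V : ℝ → ℂ := fun y => (2 * (α : ℂ))⁻¹ * ∫ s, ((Real.exp (-(α * |y - s|)) : ℝ) : ℂ) * (U s : ℂ) with hV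
  have hI : ∫ y, ((U y : ℂ) * ω y + (U'' y : ℂ) * ψ y) = (α : ℂ) ^ 2 * ∫ y, V y * ω y :=
    coupling_integral_eq hα hUd hU'd hUb hU''c hU''b1 iU'' hωc hωbdd iω hψT hV
  have hmass : (σ + (α : ℂ) ^ 2) * ∫ y, ω y = -(Complex.I * a) * ∫ y, ((U y : ℂ) * ω y + (U'' y : ℂ) * ψ y) :=
    integral_mode_eq hd1 hd2 iω iF iyω₁ iyω iω₁ iω₂ heq'
  have hVω : ‖∫ y, V y * ω y‖ ≤ KU / α * N₁ := norm_integral_green_mul_le hα hUc hUb hUodd hV hθ0 hωc iN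
  set m : ℂ := ∫ y, ω y with hm
  have hαinv : α * α⁻¹ = 1 := mul_inv_cancel₀ hα.ne'
  have hm_bound : ‖m‖ ≤ Re * KU * N₁ := by
    have h1 : ‖(σ + (α : ℂ) ^ 2) * m‖ ≤ a * (α ^ 2 * (KU / α * N₁)) := by
      rw [hmass, hI, norm_mul, norm_neg, norm_mul, Complex.norm_I, one_mul, Complex.norm_real, Real.norm_of_nonneg ha0,
        norm_mul, norm_pow, Complex.norm_real, Real.norm_of_nonneg hα.le]
      exact mul_le_mul_of_nonneg_left (mul_le_mul_of_nonneg_left hVω (by positivity)) ha0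
    have h2 : α ^ 2 * ‖m‖ ≤ ‖(σ + (α : ℂ) ^ 2) * m‖ := by
      rw [norm_mul]
      refine mul_le_mul_of_nonneg_right ?_ (norm_nonneg _)
      refine le_trans ?_ (Complex.re_le_norm _)
      simp only [Complex.add_re]
      have : ((α : ℂ) ^ 2).re = α ^ 2 := by rw [← Complex.ofReal_pow, Complex.ofReal_re]
      rw [this]; linarith only [hσ]
    have h3 : α ^ 2 * ‖m‖ ≤ α ^ 2 * (Re * KU * N₁) := by
      refine (h2.trans h1).trans (le_of_eq ?_)
      rw [ha, div_eq_mul_inv]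
      linear_combination (α ^ 2 * Re * KU * N₁) * hαinv
    exact le_of_mul_le_mul_left h3 (by positivity)
  ------------------------------------------------------------------
  -- Step 8: closing the loop: `D ≤ Re K* D`, hence `D = 0`
  ------------------------------------------------------------------
  have hc₀' : ‖ω 0‖ ≤ k₁ * N₁ := by
    have h1 : ‖ω 0‖ * KU ≤ Re * KU * N₁ + N₁ := hc₀.trans (by linarith only [hm_bound])
    have h2 : ‖ω 0‖ ≤ (Re * KU * N₁ + N₁) / KU := by rw [le_div_iff₀ hKUpos]; exact h1
    refine h2.trans ?_
    rw [hk₁, div_eq_mul_inv]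
    have hKUinv : KU * KU⁻¹ = 1 := mul_inv_cancel₀ hKUpos.ne'
    have h3 : (Re * KU * N₁ + N₁) * KU⁻¹ = (Re + KU⁻¹) * N₁ := by linear_combination (Re * N₁) * hKUinv
    rw [h3]
    exact mul_le_mul_of_nonneg_right (by linarith only [hRe1']) hN₁0
  have hS₁' : ∫ y, ‖ω y‖ ≤ (1 + k₁ * KG) * N₁ := by
    refine hS₁.trans ?_
    have h : ‖ω 0‖ * KG ≤ k₁ * N₁ * KG := mul_le_mul_of_nonneg_right hc₀' hKG0
    calc N₁ + ‖ω 0‖ * KG ≤ N₁ + k₁ * N₁ * KG := by linarith only [h]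
      _ = (1 + k₁ * KG) * N₁ := by ring
  have hS₂' : ∫ y, |y| * ‖ω y‖ ≤ (1 + k₁ * KG') * N₁ := by
    refine hS₂.trans ?_
    have h : ‖ω 0‖ * KG' ≤ k₁ * N₁ * KG' := mul_le_mul_of_nonneg_right hc₀' hKG'0
    calc N₁ + ‖ω 0‖ * KG' ≤ N₁ + k₁ * N₁ * KG' := by linarith only [h]
      _ = (1 + k₁ * KG') * N₁ := by ring
  have hDle : D ≤ Re * Kstar * D := by
    have h1 : D ≤ |a| * ((2 * α)⁻¹ * ∫ s, ‖ω s‖) * ∫ y, |y| * ‖ω y‖ := hD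
    rw [abs_of_nonneg ha0, ha] at h1
    have h2 : α * Re * ((2 * α)⁻¹ * ∫ s, ‖ω s‖) * ∫ y, |y| * ‖ω y‖ = Re / 2 * ((∫ s, ‖ω s‖) * ∫ y, |y| * ‖ω y‖) := by
      rw [mul_inv]
      linear_combination (Re * 2⁻¹ * (∫ s, ‖ω s‖) * ∫ y, |y| * ‖ω y‖) * hαinv
    rw [h2] at h1
    have hI1 : 0 ≤ ∫ s, ‖ω s‖ := integral_nonneg fun y => norm_nonneg _
    have hI2 : 0 ≤ ∫ y, |y| * ‖ω y‖ := integral_nonneg fun y => by positivity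
    have h3 : (∫ s, ‖ω s‖) * ∫ y, |y| * ‖ω y‖ ≤ ((1 + k₁ * KG) * N₁) * ((1 + k₁ * KG') * N₁) :=
      mul_le_mul hS₁' hS₂' hI2 (by positivity)
    have h4 : N₁ ^ 2 ≤ KP ^ 2 * D := by
      have h5 : N₁ ^ 2 ≤ (KP * Real.sqrt D) ^ 2 := by gcongr
      rwa [mul_pow, Real.sq_sqrt hD0] at h5
    calc D ≤ Re / 2 * ((∫ s, ‖ω s‖) * ∫ y, |y| * ‖ω y‖) := h1
      _ ≤ Re / 2 * (((1 + k₁ * KG) * N₁) * ((1 + k₁ * KG') * N₁)) := by gcongr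
      _ = Re / 2 * ((1 + k₁ * KG) * (1 + k₁ * KG')) * N₁ ^ 2 := by ring
      _ ≤ Re / 2 * ((1 + k₁ * KG) * (1 + k₁ * KG')) * (KP ^ 2 * D) := by gcongr
      _ = Re * Kstar * D := by rw [hKstar]; ring
  have hDzero : D = 0 := by
    have h1 : D * (1 - Re * Kstar) ≤ 0 := by linarith only [hDle]
    have h2 : 0 < 1 - Re * Kstar := by linarith only [hReK]
    have h3 : D ≤ 0 := by
      by_contra h4
      have h5 : 0 < D * (1 - Re * Kstar) := mul_pos (lt_of_not_ge h4) h2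
      linarith only [h1, h5]
    exact le_antisymm h3 hD0
  ------------------------------------------------------------------
  -- Step 9: `ω⊥ = 0`, `∫ω = 0`, `ω = 0`, `ψ = 0`
  ------------------------------------------------------------------
  have hN₁zero : N₁ = 0 := by
    have h : N₁ ≤ 0 := by rw [hDzero, Real.sqrt_zero, mul_zero] at hN₁D; exact hN₁D
    exact le_antisymm h hN₁0
  have hperp : ∀ y, ω y = ((Real.exp (-(θ * y ^ 2 / 2)) : ℝ) : ℂ) * ω 0 := by
    have hcont : Continuous fun y : ℝ => (1 + |y|) * ‖ω y - ((Real.exp (-(θ * y ^ 2 / 2)) : ℝ) : ℂ) * ω 0‖ := by fun_prop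
    have hae := (integral_eq_zero_iff_of_nonneg (fun y => by positivity) iN).1 (hN₁ ▸ hN₁zero)
    have hfun := (hcont.ae_eq_iff_eq volume continuous_const).1 hae
    intro y
    have h : (1 + |y|) * ‖ω y - ((Real.exp (-(θ * y ^ 2 / 2)) : ℝ) : ℂ) * ω 0‖ = 0 := congrFun hfun y
    rcases mul_eq_zero.1 h with h | h
    · exfalso; linarith only [h, abs_nonneg y]
    · exact sub_eq_zero.1 (norm_eq_zero.1 h)
  have hm0 : m = 0 := by
    have h : ‖m‖ ≤ 0 := by rw [hN₁zero, mul_zero] at hm_bound; exact hm_bound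
    exact norm_le_zero_iff.1 h
  have hω0 : ω 0 = 0 := by
    have h : ‖ω 0‖ * KU ≤ 0 := by
      have h' := hc₀
      rw [hN₁zero, add_zero, hm0, norm_zero] at h'
      exact h'
    have h2 : ‖ω 0‖ ≤ 0 := le_of_mul_le_mul_right (h.trans_eq (zero_mul KU).symm) hKUpos
    exact norm_le_zero_iff.1 h2
  have hωzero : ∀ y, ω y = 0 := fun y => by rw [hperp y, hω0, mul_zero]
  have hψ1' : ∀ y, HasDerivAt (deriv ψ) ((α : ℂ) ^ 2 * ψ y) y := fun y =>
    (hψ1 y).congr_deriv (by rw [hωzero y, sub_zero])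
  exact eq_zero_of_bounded_solution hα hψ0 hψ1' hBψ

end Main

end Summit.AnomalousDissipation.AnomalousDissipation.Theorems.MarginalStabilityChainBurgersLayerLowRe
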